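import Literature.AnabelianGeometry.EtaleTheta.Discharge.Sec3Prop34iNode
import Literature.AnabelianGeometry.EtaleTheta.Discharge.Sec3Prop34iDivPlusPrinted
import Literature.AnabelianGeometry.EtaleTheta.Discharge.Sec3Remark364
import HarnessLib

/-!
# [EtTh] Prop. 3.4 (i) AS PRINTED at the node level: `Φ₀` of the universal combinatorial covering is `Div⁺(Z^log_∞)`, so
# the LITERAL structure `Prop34 treeMonoidVocab` is REFUTED at every Def. 3.3 (iii) datum with infinitely many special-fibre
# components — in particular at both Tate towers of record — and decided in general by finiteness of the primes

S. Mochizuki, *The étale theta function …*, Publ. RIMS **45** (2009) [MochizukiEtTh2009], §3, Prop. 3.4 (i), PRIMS PDF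
p. 74 l. 27–39 ("`Φ₀(Y^log)`, as well as each of the monoids `Div⁺(Z_∞^log)^{Gal(Z_∞^log/Y^log)}` …, is perf-factorial [cf.
[Mzk17], Definition 2.4, (i)]"); S. Mochizuki, *The geometry of Frobenioids I* (2008), Def. 2.4 (i)(d) p. 47
[cite: MochizukiEtTh2009, Prop 3.4 p.74].

PROOF-ONLY sequel of `Sec3Prop34iNode.lean` (abc-iut cell, layer L2, cone node `EtTh:Prop3.4(i)`; seat abc-iut-w6-d058 gen 6;
abc-iut-L2-lead R989; theorems only, 0 defs).  Cell erratum-candidate E-14 / finding F-L2d2-1 (abc-iut-L2-d2; kernel root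
`PerfFactorialProductCounterexample.not_isPerfFactorial_multiplicative_pi_nat`, p413961) says clause (d) of "perf-factorial"
fails for monoids with infinitely many primes; abc-iut-w6-d057 decided it at the interface for `Div⁺(Z^log_∞)`
(`LogDivisorModel.prop34_i_Divplus_printed_iff_finite`, `Sec3Prop34iDivPlusPrinted`, p435031).  THIS FILE carries that decision
to the NODE's own objects — the constructed `Φ₀` at the universal covering `Z^log_∞` itself (the regular `G`-set `G/1`, an
object of `D₀`):

* `LogDivisorModel.GaloisAction.nonempty_phiZero_leftRegular_mulEquiv` — `Φ₀(G/1) = Hom_G(G, Div⁺(Z^log_∞)) ≅ Div⁺(Z^log_∞)`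
  (evaluate at `1`; inverse `d ↦ (g ↦ g·d)`);
* `prop34_i_phiZero_leftRegular_printed_iff_finite` — print's LITERAL clause (i)(a) at `Φ₀(G/1)` ⟺ `Cusp ⊔ Comp` finite;
* **`DivisorMonoids.not_prop34_printed_ofGaloisActionConnected`** — for every `(Z, G, A, hZ)` with INFINITELY MANY special-fibre
  components (or cusps, `…_of_infinite_cusp`) the typed structure in the PRINTED vocabulary,
  `(ofGaloisActionConnected A hZ).Prop34 treeMonoidVocab (treeCatVocab _ R R')`, is FALSE;
* **`LogDivisorModel.TateTower.not_prop34_printed`**, **`LogDivisorModel.TateTowerArith.Datum.not_prop34_printed`** — in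
  particular at the Tate tower v1 and at the arithmetic tower (special fibre = an infinite chain of `ℙ¹`'s, `Comp = ℤ`).
Together with `Sec3Prop34iNode.lean`: the WEAK-reading structure holds at all these data (`…prop34_node`), the PRINTED one
holds at the one-component model (`OneCompFrd.prop34_printed`) and fails at the towers — the E-14 dichotomy at node level.
HONEST FRAMING: statements about the typed interface, the cell's class-(b) models and a classical definition; the erratum is
displayed, not adjudicated (not author-corrected); nothing here bears on [IUTchIII] Cor. 3.12; no side taken; typed ≠ proved.
-/

namespace Literature.AnabelianGeometry.EtaleTheta

open CategoryTheory Opposite Function Literature.AlgebraicGeometry.Frobenioids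

universe u

namespace LogDivisorModel.GaloisAction

variable {Z : LogDivisorModel.{u}} {G : Type u} [Group G] (A : Z.GaloisAction G)

/-- The Galois action preserves the Cartier effective log-divisors `Div⁺ = Div ∩ DIV⁺`. [cite: MochizukiEtTh2009, Def 3.1 p.70] -/
theorem actDIV_mem_Divplus (g : G) {d : Z.DIV} (hd : d ∈ Z.Divplus) : A.actDIV g d ∈ Z.Divplus :=
  Submonoid.mem_inf.mpr ⟨A.act_mem_Div g (Submonoid.mem_inf.mp hd).1, A.act_mem_DIVplus g (Submonoid.mem_inf.mp hd).2⟩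

/-- **`Φ₀(G/1) ≅ Div⁺(Z^log_∞)`**: an equivariant family of log-divisors on the regular `G`-set is its value at `1`
(`φ(g) = g · φ(1)`). [cite: MochizukiEtTh2009, Def 3.3 p.73] -/
theorem nonempty_phiZero_leftRegular_mulEquiv : Nonempty (↥(A.phiZero (Action.leftRegular G)) ≃* ↥Z.Divplus) := by
  have hρ : ∀ g h : G, (Action.leftRegular G).ρ g h = g * h := fun g h => by
    rw [Action.ofMulAction_apply, smul_eq_mul]
  refine ⟨{ toFun := fun φ => ⟨φ.1 (1 : G), φ.2.1 (1 : G)⟩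
            invFun := fun d => ⟨fun g => A.actDIV g d.1, fun g => A.actDIV_mem_Divplus g d.2, fun g h => by
              show A.actDIV ((Action.leftRegular G).ρ g h) d.1 = A.actDIV g (A.actDIV h d.1)
              rw [hρ, map_mul, MulAut.mul_apply]⟩
            left_inv := fun φ => Subtype.ext (funext fun g => by
              show A.actDIV g (φ.1 (1 : G)) = φ.1 g
              rw [← φ.2.2 g (1 : G), hρ, mul_one])
            right_inv := fun d => Subtype.ext (by
              show A.actDIV (1 : G) d.1 = d.1
              rw [map_one, MulAut.one_apply])
            map_mul' := fun _ _ => rfl }⟩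

/-- **Print's LITERAL Prop. 3.4 (i)(a) at `Φ₀` of the universal covering ⟺ finitely many prime log-divisors**
(`V := treeMonoidVocab`, [FrdI] Def. 2.4 (i) WITH clause (d); abc-iut-w6-d057's dichotomy for `Div⁺(Z^log_∞)` transported
along `Φ₀(G/1) ≅ Div⁺(Z^log_∞)`). [cite: MochizukiEtTh2009, Prop 3.4 p.74] -/
theorem prop34_i_phiZero_leftRegular_printed_iff_finite :
    treeMonoidVocab.IsPerfFactorial ↥(A.phiZero (Action.leftRegular G)) ↔ Finite (Z.Cusp ⊕ Z.Comp) := by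
  obtain ⟨e⟩ := A.nonempty_phiZero_leftRegular_mulEquiv
  rw [treeMonoidVocab_isPerfFactorial, ← Z.isPerfFactorial_Divplus_iff_finite]
  exact ⟨fun h => isPerfFactorial_of_mulEquiv e h, fun h => isPerfFactorial_of_mulEquiv e.symm h⟩

end LogDivisorModel.GaloisAction

namespace DivisorMonoids

open LogDivisorModel.GaloisAction

variable {Z : LogDivisorModel.{u}} {G : Type u} [Group G] (A : Z.GaloisAction G) (hZ : Z.CuspLaws)
  (R R' : (((isConnectedGSet (G := G)).FullSubcategory)ᵒᵖ ⥤ CommMonCat.{u}) → Prop)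

/-- **The typed node structure in the PRINTED vocabulary is FALSE at every Def. 3.3 (iii) datum with infinitely many
special-fibre components** (E-14 at node level: its clause (i)(a) at the object `G/1 = Z^log_∞` of `D₀` would make
`Div⁺(Z^log_∞)` perf-factorial as printed). [cite: MochizukiEtTh2009, Prop 3.4 p.74] -/
theorem not_prop34_printed_ofGaloisActionConnected [Infinite Z.Comp] :
    ¬ (ofGaloisActionConnected A hZ).Prop34 treeMonoidVocab.{u} (treeCatVocab _ R R') := fun h =>
  (not_finite_iff_infinite.mpr (inferInstance : Infinite (Z.Cusp ⊕ Z.Comp)))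
    ((prop34_i_phiZero_leftRegular_printed_iff_finite A).mp
      (h.isPerfFactorial (op ⟨Action.leftRegular G, isConnectedGSet_leftRegular⟩)))

/-- … and likewise with infinitely many cusps. [cite: MochizukiEtTh2009, Prop 3.4 p.74] -/
theorem not_prop34_printed_ofGaloisActionConnected_of_infinite_cusp [Infinite Z.Cusp] :
    ¬ (ofGaloisActionConnected A hZ).Prop34 treeMonoidVocab.{u} (treeCatVocab _ R R') := fun h =>
  (not_finite_iff_infinite.mpr (inferInstance : Infinite (Z.Cusp ⊕ Z.Comp)))
    ((prop34_i_phiZero_leftRegular_printed_iff_finite A).mp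
      (h.isPerfFactorial (op ⟨Action.leftRegular G, isConnectedGSet_leftRegular⟩)))

/-- Conversely the printed structure FORCES finitely many cusps and components (contrapositive form, no instance
hypothesis). [cite: MochizukiEtTh2009, Prop 3.4 p.74] -/
theorem finite_of_prop34_printed_ofGaloisActionConnected
    (h : (ofGaloisActionConnected A hZ).Prop34 treeMonoidVocab.{u} (treeCatVocab _ R R')) : Finite (Z.Cusp ⊕ Z.Comp) :=
  (prop34_i_phiZero_leftRegular_printed_iff_finite A).mp
    (h.isPerfFactorial (op ⟨Action.leftRegular G, isConnectedGSet_leftRegular⟩))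

end DivisorMonoids

/-! ### At the Tate towers of record: the printed structure fails, the weak one holds (`Sec3Prop34iNode`) -/

namespace LogDivisorModel

/-- **At the Tate tower v1** (special fibre an infinite chain of `ℙ¹`'s, `Comp = ℤ`): print's LITERAL Prop. 3.4 structure is
FALSE — while `TateTower.prop34_node` (weak reading of record) holds with no hypothesis. [cite: MochizukiEtTh2009, Prop 3.4 p.74] -/
theorem TateTower.not_prop34_printed
    (R R' : (((GaloisAction.isConnectedGSet (G := Multiplicative ℤ)).FullSubcategory)ᵒᵖ ⥤ CommMonCat.{0}) → Prop) :
    ¬ (DivisorMonoids.ofGaloisActionConnected TateTower.action TateTower.cuspLaws).Prop34 treeMonoidVocab.{0}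
      (treeCatVocab _ R R') :=
  haveI : Infinite TateTower.model.Comp := show Infinite ℤ from inferInstance
  DivisorMonoids.not_prop34_printed_ofGaloisActionConnected TateTower.action TateTower.cuspLaws R R'

/-- **At the arithmetic Tate tower** (every `D : TateTowerArith.Datum K L`; `Comp = ℤ`): print's LITERAL Prop. 3.4 structure
is FALSE — while `TateTowerArith.Datum.prop34_node` holds with no hypothesis. [cite: MochizukiEtTh2009, Prop 3.4 p.74] -/
theorem TateTowerArith.Datum.not_prop34_printed {K L : Type} [Field K] [Field L] [Algebra K L]
    (D : TateTowerArith.Datum K L)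
    (R R' : (((GaloisAction.isConnectedGSet (G := TateTowerArith.Grp K L)).FullSubcategory)ᵒᵖ ⥤ CommMonCat.{0}) → Prop) :
    ¬ (DivisorMonoids.ofGaloisActionConnected D.action D.cuspLaws).Prop34 treeMonoidVocab.{0} (treeCatVocab _ R R') :=
  haveI : Infinite D.model.Comp := show Infinite ℤ from inferInstance
  DivisorMonoids.not_prop34_printed_ofGaloisActionConnected D.action D.cuspLaws R R'

end LogDivisorModel

end Literature.AnabelianGeometry.EtaleTheta
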